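import Summits.BirchSwinnertonDyer.Rank1Residual.GaloisImage.MultiplicativeLocalTorsion
import HarnessLib

/-!
# X11b rank-one visibility in the INDEX currency: `hrank : 3 ≤ rank E′` replaced by a displayed
# Mordell–Weil index bound `m ≤ [E′(ℚ) : pE′(ℚ)]` with `p² < m` (team n1011 seat p17 for team x11b3;
# x11b3-lead R22-3, 2026-08-22T03:25Z: "the index-currency twins of the three `X11b` visibility
# wrappers are yours to write when you choose (sibling-file shape, parents byte-unchanged)")

HONEST FRAMING (cell `b2b-bsdres`, run/shared/lean/b2b/bsd-rank1-residual/, verbatim in every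
file): the goal of the cell is to DELETE the COMBINATION-SHAPED residual classes of the
Birch–Swinnerton-Dyer formula for ALL analytic-rank `≤ 1` elliptic curves over `ℚ` — "full BSD
formula for every rank `≤ 1` curve in class `C`" assembled STRICTLY from published theorems — so
that the rank-`≤ 1` remainder becomes exactly the CONSTRUCTION-SHAPED classes, which are TYPED
(missing-input `Prop`s), NOT attempted. This is not "finishing BSD". Classes X11b / X4 stay
CONSTRUCTION-SHAPED; this file is a TOOL (a certificate SHAPE per pair), not a class theorem; it
closes nothing by itself, books nothing, moves no mark / label / count. THEOREMS only; no
definition, no named fact, no `sorry`. The parents `X11b/VisibilityRankOne.lean`,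
`X11b/VisibilityPrimeList.lean`, `GaloisImage/MultiplicativeLocalTorsion.lean` are byte-unchanged
(sibling file).

## What

x11c's rank-one visibility lever `X11b.bsdp_of_kolyvagin_of_congr[_of_primeList[_of_mult]]`
(Kolyvagin's UPPER half + Cassels–Tate + a VISIBLE `Ш(E)[p] ≠ 0` from a `p`-congruent partner `E′`)
displays the partner's Mordell–Weil rank as an EVIDENCE binder `hrank : 3 ≤ rank E′(ℚ)`. The
Cremona–Mazur count only needs `[E(ℚ):pE(ℚ)] · ∏_{v ∈ S} #E′(ℚ_v)[p] · p < [E′(ℚ):pE′(ℚ)]`, i.e. with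
`E(ℚ)[p] = 0`, `rank E = 1` and `#E′(ℚ_v)[p] = 1` on `S`: `p² < [E′(ℚ):pE′(ℚ)]`. This file re-derives
the three wrappers with `hrank` REPLACED by `{m : ℕ} (hm : p ^ 2 < m) (hidx : m ≤ [E′(ℚ):pE′(ℚ)])`,
the index stated (as in n1011's `GaloisImage/VisibleIndexBudget.lean`) for the CLASSICAL
`DecidableEq ℚ` instance under which the Literature count is elaborated. At `p = 3` the binder
`hidx` with `m = 27` is a KERNEL CERTIFICATE: n1011-p17's
`GaloisImage.DivisionDecider.twentyseven_le_index_range_zsmul_three_of_checks`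
(`GaloisImage/MordellWeilIndexCertificatesThree.lean`: three rational points of `E′`, ten chords,
thirteen NO-prime certificates `threeNonDivCheckAt … = true` by `decide +kernel`; per-partner
instances `twentyseven_le_index_<label> … (d : DecidableEq ℚ)`, to be applied with
`d := fun a b => Classical.propDecidable (a = b)`), so a rank-3 partner row needs NO rank statement.

* `exists_sha_ne_zero_of_congr_of_le_index` — the count for `E/K` of any rank with `E(K)[p] = 0`,
  `#E′(K_v)[p] = 1` on `S`, and `p^{rank E + [K:ℚ]} < m ≤ [E′(K):pE′(K)]` (K-general; the index twin
  of x11c's `exists_sha_ne_zero_of_congr_of_rank_add`).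
* `bsdp_of_kolyvagin_of_congr_of_index`, `…_of_index_of_primeList`,
  `…_of_index_of_primeList_of_mult` — the three wrappers, every other binder token-for-token the
  parent's.

References: [CremonaMazur2000] §3; [AgasheStein2002] Lemma 3.6, Thm. 3.1; [McCallumLMS1991] §1;
[SilvermanAEC2009] VIII.6.7, X.1.4, X.4.14, VII.5.1; [SerreInventiones1972] §1.12.
-/

noncomputable section

open scoped Classical

open WeierstrassCurve Literature.NumberTheory.EllipticCurves
  Literature.NumberTheory.EllipticCurves.Rank1Residual
  Literature.NumberTheory.EllipticCurves.Rank1Residual.Typed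
  Literature.NumberTheory.GaloisRepresentations
open NumberField IsDedekindDomain

namespace Summit.BirchSwinnertonDyer.Rank1Residual.X11b

/-! ### §1. The count in the index currency, `E` of any rank -/

section Count

variable {K : Type} [Field K] [NumberField K] (W W' : WeierstrassCurve K) [W.IsElliptic]
  [W'.IsElliptic] {p : ℕ} [Fact p.Prime]

/-- **Visible `Ш(E/K)[p] ≠ 0` from a `p`-congruent curve with a displayed Mordell–Weil INDEX bound**
(the index twin of `exists_sha_ne_zero_of_congr_of_rank_add`): `p` odd, `θ : E′[p] ≅ E[p]`
`Γ_K`-equivariant, `S` a finite set of finite places outside which `E, E′` have good reduction and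
which contains the places above `p`, `E(K)[p] = 0`, `E′(K_v)[p] = 0` for `v ∈ S`, and
`p^{rank E(K) + [K:ℚ]} < m ≤ [E′(K):pE′(K)]`. Then `[E(K):pE(K)] · ∏_{v∈S} #E′(K_v)[p] · p^{[K:ℚ]} =
p^{rank E + [K:ℚ]} < m ≤ [E′(K):pE′(K)]` and the KERNEL count `exists_sha_ne_zero_of_congr`
(Cremona–Mazur / Agashe–Stein, no condition at `p`) applies. [cite: CremonaMazur2000, §3 pp. 19–22]
[cite: AgasheStein2002, Lemma 3.6 and Thm. 3.1] -/
theorem exists_sha_ne_zero_of_congr_of_le_index (hp2 : p ≠ 2)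
    (θ : geomTorsion W' (p : ℤ) ≃+ geomTorsion W (p : ℤ))
    (hθ : ∀ (σ : Field.absoluteGaloisGroup K) (P : geomTorsion W' (p : ℤ)), θ (σ • P) = σ • θ P)
    (S : Finset (HeightOneSpectrum (𝓞 K)))
    (hS : ∀ v : HeightOneSpectrum (𝓞 K), v ∉ S →
      W.HasGoodReductionAt v ∧ W'.HasGoodReductionAt v ∧ (p : 𝓞 K) ∉ v.asIdeal)
    (htors : Nat.card (AddSubgroup.torsionBy W.toAffine.Point (p : ℤ)) = 1)
    {m : ℕ} (hm : p ^ (W.mordellWeilRank + Module.finrank ℚ K) < m)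
    (hidx : m ≤ (zsmulAddGroupHom (p : ℤ) : W'.toAffine.Point →+ W'.toAffine.Point).range.index)
    (hloc : ∀ v ∈ S, Nat.card (nsmulAddMonoidHom p :
      (W'.baseChange (v.adicCompletion K)).toAffine.Point →+ _).ker = 1) :
    ∃ c : W.sha, c ≠ 0 ∧ p • c = 0 := by
  have hp : p.Prime := Fact.out
  refine exists_sha_ne_zero_of_congr W W' hp2 θ hθ S hS ?_
  rw [index_range_zsmul_eq_pow_rank_mul_card_torsionBy W hp.ne_zero, htors, mul_one,
    Finset.prod_eq_one hloc, mul_one, ← pow_add]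
  exact lt_of_lt_of_le hm hidx

end Count

/-! ### §2. The three rank-one wrappers with `hrank` replaced by the index bound -/

section Assembly

variable (W : WeierstrassCurve ℚ) [W.IsElliptic] (p : ℕ) [Fact p.Prime]

/-- **X11b rank-one visibility lever in the INDEX currency** — `X11b.bsdp_of_kolyvagin_of_congr`
with the partner's rank binder `hrank : 3 ≤ rank E′(ℚ)` REPLACED by `p² < m ≤ [E′(ℚ):pE′(ℚ)]`
(index for the classical `DecidableEq ℚ` instance; at `p = 3`, `m = 27` is n1011-p17's kernel
certificate `twentyseven_le_index_range_zsmul_three_of_checks`). UPPER half Kolyvagin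
(`padicValNat_shaOrder_le_of_kolyvagin`), LOWER half the visible element + Cassels–Tate, verbatim
the parent's. Per pair; not a class theorem; nothing booked.
[cite: McCallumLMS1991, §1 Theorem (Kolyvagin), p. 296] [cite: SilvermanAEC2009, Thm. X.4.14]
[cite: CremonaMazur2000, §3 and Table 1] -/
theorem bsdp_of_kolyvagin_of_congr_of_index (hCT : exists_casselsTate_pairing (K := ℚ))
    (hGZK : rank_eq_analyticRank_of_analyticRank_le_one)
    {N : ℕ} [NeZero N] {K : Type} [Field K] [NumberField K] (hKo : kolyvagin N W K)
    (hB : Kolyvagin1990_padicValNat_card_sha_le N W K) (hK : IsImaginaryQuadratic K)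
    (hH : SatisfiesHeegnerHypothesis N K) {P : (W.baseChange K).toAffine.Point}
    (hP : IsHeegnerPoint N W K P) (hnt : ¬ IsOfFinAddOrder P)
    (hp2 : p ≠ 2) (hρ : W.HasSurjectiveModNGaloisRep p)
    (hI : padicValNat p (AddSubgroup.zmultiples P).index ≤ 1)
    (hr : W.analyticRank = 1) {s : ℚ} (hs : shaAn W = (s : ℂ)) (hv : padicValRat p s = 2)
    (W' : WeierstrassCurve ℚ) [W'.IsElliptic]
    (θ : geomTorsion W' (p : ℤ) ≃+ geomTorsion W (p : ℤ))
    (hθ : ∀ (σ : Field.absoluteGaloisGroup ℚ) (P : geomTorsion W' (p : ℤ)), θ (σ • P) = σ • θ P)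
    {m : ℕ} (hm : p ^ 2 < m)
    (hidx : m ≤ (letI : DecidableEq ℚ := fun a b => Classical.propDecidable (a = b)
      (zsmulAddGroupHom (p : ℤ) : W'.toAffine.Point →+ W'.toAffine.Point).range.index))
    (S : Finset (HeightOneSpectrum (𝓞 ℚ)))
    (hS : ∀ v : HeightOneSpectrum (𝓞 ℚ), v ∉ S →
      W.HasGoodReductionAt v ∧ W'.HasGoodReductionAt v ∧ (p : 𝓞 ℚ) ∉ v.asIdeal)
    (hloc : ∀ v ∈ S, Nat.card (nsmulAddMonoidHom p :
      (W'.baseChange (v.adicCompletion ℚ)).toAffine.Point →+ _).ker = 1) :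
    BSDp W p := by
  obtain ⟨hrk, hfin⟩ := hGZK W (by omega)
  haveI : NeZero (p : ℚ) := ⟨by exact_mod_cast (Fact.out : p.Prime).ne_zero⟩
  have hirr : Irr W p := hasIrreducibleModPGaloisRep_of_hasSurjectiveModNGaloisRep W p hρ
  have hm' : p ^ (W.mordellWeilRank + Module.finrank ℚ ℚ) < m := by
    rw [hrk, hr, Module.finrank_self]; exact hm
  -- LOWER half: a visible non-zero element of `Ш(E/ℚ)[p]` (no rational `p`-torsion since `E[p]` is
  -- irreducible), by the count in the index currency, then Cassels–Tate squareness
  have hdvd : p ∣ W.shaOrder :=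
    dvd_shaOrder_of_exists_torsion W p
      (exists_sha_ne_zero_of_congr_of_le_index W W' hp2 θ hθ S hS
        ((natCard_torsionBy_point_eq_of_subsingleton W _ _ _).trans
          (natCard_torsionBy_eq_one_of_hasIrreducibleModPGaloisRep W p hirr)) hm' hidx hloc)
  have hlow : MissingLowerBoundAt W p :=
    missingLowerBoundAt_of_casselsTate_of_pow_dvd W p hCT hfin hs (k := 1)
      (by rw [hv]; norm_num) (by simpa using hdvd)
  -- UPPER half: Kolyvagin
  have hup : MissingUpperBoundAt W p :=
    missingUpperBoundAt_of_padicValNat_shaOrder_le W p (k := 1)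
      (padicValNat_shaOrder_le_of_kolyvagin W p hKo hB hK hH hP hnt hp2 hρ hfin hI)
      hs (by rw [hv]; norm_num)
  exact bsdp_of_missingPPartAt W p hGZK (by omega) (missingPPartAt_of_lower_of_upper W p hlow hup)

/-- **Prime-list form in the INDEX currency** — `X11b.bsdp_of_kolyvagin_of_congr_of_primeList` with
`hrank` replaced by `p² < m ≤ [E′(ℚ):pE′(ℚ)]`: `S` = the places over a list of rational primes
`L ∋ p` supporting both discriminants of integer models `E₀`, `F₀` (outside them both curves are
good, Silverman AEC VII.5.1(a), and the place does not divide `p`).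
[cite: SilvermanAEC2009, VII.5 Prop. 5.1(a)] [cite: CremonaMazur2000, §3 and Table 1] -/
theorem bsdp_of_kolyvagin_of_congr_of_index_of_primeList (hCT : exists_casselsTate_pairing (K := ℚ))
    (hGZK : rank_eq_analyticRank_of_analyticRank_le_one)
    {N : ℕ} [NeZero N] {K : Type} [Field K] [NumberField K] (hKo : kolyvagin N W K)
    (hB : Kolyvagin1990_padicValNat_card_sha_le N W K) (hK : IsImaginaryQuadratic K)
    (hH : SatisfiesHeegnerHypothesis N K) {P : (W.baseChange K).toAffine.Point}
    (hP : IsHeegnerPoint N W K P) (hnt : ¬ IsOfFinAddOrder P)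
    (hp2 : p ≠ 2) (hρ : W.HasSurjectiveModNGaloisRep p)
    (hI : padicValNat p (AddSubgroup.zmultiples P).index ≤ 1)
    (hr : W.analyticRank = 1) {s : ℚ} (hs : shaAn W = (s : ℂ)) (hv : padicValRat p s = 2)
    (W' : WeierstrassCurve ℚ) [W'.IsElliptic]
    (θ : geomTorsion W' (p : ℤ) ≃+ geomTorsion W (p : ℤ))
    (hθ : ∀ (σ : Field.absoluteGaloisGroup ℚ) (P : geomTorsion W' (p : ℤ)), θ (σ • P) = σ • θ P)
    {m : ℕ} (hm : p ^ 2 < m)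
    (hidx : m ≤ (letI : DecidableEq ℚ := fun a b => Classical.propDecidable (a = b)
      (zsmulAddGroupHom (p : ℤ) : W'.toAffine.Point →+ W'.toAffine.Point).range.index))
    {E₀ F₀ : WeierstrassCurve ℤ} (hE : E₀.map (Int.castRingHom ℚ) = W)
    (hF : F₀.map (Int.castRingHom ℚ) = W') (L : List ℕ) (hpL : p ∈ L)
    (hΔE : ∀ q : ℕ, q.Prime → (q : ℤ) ∣ E₀.Δ → q ∈ L)
    (hΔF : ∀ q : ℕ, q.Prime → (q : ℤ) ∣ F₀.Δ → q ∈ L)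
    (hloc : ∀ v : HeightOneSpectrum (𝓞 ℚ), (Rat.HeightOneSpectrum.primesEquiv v : ℕ) ∈ L →
      Nat.card (nsmulAddMonoidHom p :
        (W'.baseChange (v.adicCompletion ℚ)).toAffine.Point →+ _).ker = 1) :
    BSDp W p := by
  have hp : p.Prime := Fact.out
  set e := Rat.HeightOneSpectrum.primesEquiv (R := 𝓞 ℚ) with he
  -- the finite set of places over `L`
  set S : Finset (HeightOneSpectrum (𝓞 ℚ)) :=
    (L.filterMap fun q ↦ if h : q.Prime then some (e.symm ⟨q, h⟩) else none).toFinset with hSdef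
  have hmemS : ∀ v : HeightOneSpectrum (𝓞 ℚ), v ∈ S ↔ (e v : ℕ) ∈ L := by
    intro v
    rw [hSdef, List.mem_toFinset, List.mem_filterMap]
    constructor
    · rintro ⟨q, hq, hqv⟩
      by_cases hqp : q.Prime
      · rw [dif_pos hqp, Option.some.injEq] at hqv
        rw [← hqv, Equiv.apply_symm_apply]
        exact hq
      · rw [dif_neg hqp] at hqv
        exact absurd hqv (by simp)
    · intro hv
      refine ⟨(e v : ℕ), hv, ?_⟩
      rw [dif_pos (e v).2]
      simp
  refine bsdp_of_kolyvagin_of_congr_of_index W p hCT hGZK hKo hB hK hH hP hnt hp2 hρ hI hr hs hv W'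
    θ hθ hm hidx S (fun v hvS ↦ ?_) (fun v hvS ↦ hloc v ((hmemS v).mp hvS))
  have hvL : (e v : ℕ) ∉ L := fun h ↦ hvS ((hmemS v).mpr h)
  have hq : (e v : ℕ).Prime := (e v).2
  refine ⟨?_, ?_, fun hpv ↦ hvL ?_⟩
  · rw [← hE]
    exact hasGoodReductionAt_map_of_not_dvd E₀ v fun h ↦ hvL (hΔE _ hq h)
  · rw [← hF]
    exact hasGoodReductionAt_map_of_not_dvd F₀ v fun h ↦ hvL (hΔF _ hq h)
  · rw [he, Rat.HeightOneSpectrum.primesEquiv_eq_of_natCast_mem v hp hpv]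
    exact hpL

open GaloisImage in
/-- **Prime-list form in the INDEX currency with `E′(ℚ_p)[p] = 0` PROVED** —
`X11b.bsdp_of_kolyvagin_of_congr_of_primeList_of_mult` with `hrank` replaced by
`p² < m ≤ [E′(ℚ):pE′(ℚ)]`; at `q = p` the local binder comes from `Mult W′ p` and
`¬ p ∣ ord_p j(E′)` (`natCard_ker_nsmul_adicCompletion_eq_one_of_mult_of_not_dvd_padicValRat_j`).
[cite: McCallumLMS1991, §1 Theorem (Kolyvagin), p. 296] [cite: CremonaMazur2000, §3 and Table 1]
[cite: SerreInventiones1972, §1.12 (Cor. of Prop. 13)] -/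
theorem bsdp_of_kolyvagin_of_congr_of_index_of_primeList_of_mult
    (hCT : exists_casselsTate_pairing (K := ℚ))
    (hGZK : rank_eq_analyticRank_of_analyticRank_le_one)
    {N : ℕ} [NeZero N] {K : Type} [Field K] [NumberField K] (hKo : kolyvagin N W K)
    (hB : Kolyvagin1990_padicValNat_card_sha_le N W K) (hK : IsImaginaryQuadratic K)
    (hH : SatisfiesHeegnerHypothesis N K) {P : (W.baseChange K).toAffine.Point}
    (hP : IsHeegnerPoint N W K P) (hnt : ¬ IsOfFinAddOrder P)
    (hp2 : p ≠ 2) (hρ : W.HasSurjectiveModNGaloisRep p)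
    (hI : padicValNat p (AddSubgroup.zmultiples P).index ≤ 1)
    (hr : W.analyticRank = 1) {s : ℚ} (hs : shaAn W = (s : ℂ)) (hv : padicValRat p s = 2)
    (W' : WeierstrassCurve ℚ) [W'.IsElliptic]
    (θ : geomTorsion W' (p : ℤ) ≃+ geomTorsion W (p : ℤ))
    (hθ : ∀ (σ : Field.absoluteGaloisGroup ℚ) (P : geomTorsion W' (p : ℤ)), θ (σ • P) = σ • θ P)
    {m : ℕ} (hm : p ^ 2 < m)
    (hidx : m ≤ (letI : DecidableEq ℚ := fun a b => Classical.propDecidable (a = b)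
      (zsmulAddGroupHom (p : ℤ) : W'.toAffine.Point →+ W'.toAffine.Point).range.index))
    {E₀ F₀ : WeierstrassCurve ℤ} (hE : E₀.map (Int.castRingHom ℚ) = W)
    (hF : F₀.map (Int.castRingHom ℚ) = W') (L : List ℕ) (hpL : p ∈ L)
    (hΔE : ∀ q : ℕ, q.Prime → (q : ℤ) ∣ E₀.Δ → q ∈ L)
    (hΔF : ∀ q : ℕ, q.Prime → (q : ℤ) ∣ F₀.Δ → q ∈ L)
    (hmult' : Mult W' p) (hj' : ¬ (p : ℤ) ∣ padicValRat p W'.j)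
    (hloc : ∀ v : HeightOneSpectrum (𝓞 ℚ), (Rat.HeightOneSpectrum.primesEquiv v : ℕ) ∈ L →
      (Rat.HeightOneSpectrum.primesEquiv v : ℕ) ≠ p →
      Nat.card (nsmulAddMonoidHom p :
        (W'.baseChange (v.adicCompletion ℚ)).toAffine.Point →+ _).ker = 1) :
    BSDp W p := by
  refine bsdp_of_kolyvagin_of_congr_of_index_of_primeList W p hCT hGZK hKo hB hK hH hP hnt hp2 hρ hI
    hr hs hv W' θ hθ hm hidx hE hF L hpL hΔE hΔF fun v hvL ↦ ?_
  by_cases hvp : (Rat.HeightOneSpectrum.primesEquiv v : ℕ) = p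
  · exact natCard_ker_nsmul_adicCompletion_eq_one_of_mult_of_not_dvd_padicValRat_j W' p hp2 hmult'
      hj' hvp
  · exact hloc v hvL hvp

end Assembly

end Summit.BirchSwinnertonDyer.Rank1Residual.X11b

end
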